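import Mathlib.Tactic.FinCases
import Mathlib.Data.Fintype.Sigma
import Mathlib.Data.Fintype.Option
import Literature.AlgebraicGeometry.Hu2025.Statements.S06WpEllBlowups.R107cWpEllBlowups

/-!
# Hu 2025 (arXiv:2507.21400v1) §6.1–§6.2 AS TYPED in lit/PARTITION-HU.md row 107 — NON-VACUITY of the packaging predicate
# `WpFrame.WpRun.IsAsPrinted` on a toy frame with ONE ℘-set (kernel witness), by res-type-018 (gen 5)

What is proved here, and nothing more: the conjunction (a)–(e) of `WpRun.IsAsPrinted` (file `S06WpEllBlowups/R107cWpEllBlowups.lean`: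
(a) initial package Def. 6.1/6.3, (b) rounds list exactly the ℘-sets in Def. 6.5's order, (c) Def. 6.6 at each new
℘-exceptional name, (d) `ρ_(kτ)` = Def. 6.7's least round, (e) Def. 6.9 at `E_{ℓ_k}`) is SATISFIABLE NON-TRIVIALLY: on the toy
frame `Υ = 1`, `𝔱_{F_1} = 2` (two governing binomials `B_(11)`, `B_(12)`; `u_1 = u₀`, `(u_{s_τ}, v_{s_τ}) = (u₁, u_{τ+1})`,
ϱ-indices `r₀ = (m,u_1)`, `r_τ = (u_{s_τ},v_{s_τ})`) with the TEST «exactly the pair `(X_{r₁}, X_{u₁})` meets `Ṽ`, and only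
before round 1 of `B_(11)`», the run with `ρ_(11) = 1`, `σ_(11)1 = 1`, `ϕ_(11)11 = (X_{r₁}, X_{u₁})`, `ρ_(12) = 0`, the new
divisor `E_{(11)11}` carrying Def. 6.6's multiplicities (`(0,0)` for `B_(11)`: `m_ϕ = (1,1)`, `l = 1`; `(0,1)` for `B_(12)`:
`m_ϕ = (0,1)`, `l = 0`) and `E_{ℓ_1}` copying `E_{ϑ,1}`, satisfies `IsAsPrinted` — so the indexing conventions of (b) (round `μ`
reads `𝒟_{(℘𝔯_{μ−1})}` and the test of stage `μ−1`), (c) (`E_{·,(kτ)μh}` via `excWpOf`, printed `τ = position + 1`) and (d)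
(the infimum of Def. 6.7 in `ℕ∞`) are mutually consistent in the kernel. A second witness (`R107NonVacuity2`, two blocks with
one governing binomial each) exercises the ℓ-step across blocks: `E_{ℓ_1}` (multiplicities copied from `E_{ϑ,1}` by Def. 6.9)
is a member of the ℘-set `ϕ_(21)11 = {X_{u₃}, E_{ℓ_1}}` of the next block. A third witness (`R107NonVacuity3`, `σ_(11)1 = 2`)
has TWO ℘-sets in one round: Def. 6.5's order AS TYPED lists `{X_{u_1}, X_{u₁}}` BEFORE `{X_{(u_s,v_s)}, X_{u₁}}` («X_{(u_s,v_s)}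
the largest and X_{u_k} the second largest», ϕ₁ < ϕ₂ iff Y₁⁺ < Y₂⁺ …; the listing is increasing and ϕ_(kτ)μ1 is blown up first,
C44L40–L42) — the kernel instance of the typed order. A typing self-check for the lanes' vacuity column;
it says nothing about the manuscript. Source status: UNREFEREED PREPRINT UNDER ADJUDICATION (D-0012/D-0089); AI typing, weaker
than expert review; HONEST CEILING as in lit/PARTITION-HU.md (Part I = resolution of singularity TYPES; Part II unposted).

## Sources
* Y. Hu, *Universal Characteristic-free Resolution of Singularities, I*, arXiv:2507.21400v1 (2025), §6.1–§6.2, chunks p0042 l.60 –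
  p0047 l.7 (PDF pp.95–106). [Hu2025] (ADJUDICATED, not cited as fact)
-/

namespace Literature.AlgebraicGeometry.Hu2025.Statements.S06WpEllBlowups

namespace R107NonVacuity

open WpFrame

/-- The toy frame: `Υ = 1`, `𝔱_{F_1} = 2`, ϖ-indices `P = Fin 4` (`u₀ = u_1` leading, `u₁ = u_{s_1} = u_{s_2}`, `u₂ = v_{s_1}`,
`u₃ = v_{s_2}`), ϱ-indices `Λ = Fin 3` (`r₀ = (m,u_1)`, `r₁`, `r₂` the two non-leading terms).
[cite: Hu2025, §6.1–§6.2 Def. 6.1/6.3/6.5/6.6/6.7/6.9, pp. 95–106 (unrefereed preprint arXiv:2507.21400v1 under adjudication, D-0012/D-0089 — kernel support on OUR typed carrier of row 107; nothing of the source asserted)] -/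
abbrev toy : WpFrame (Fin 4) (Fin 3) where
  N := 1
  t := fun _ => 2
  ult := fun _ => 0
  lead := fun _ => 0
  termR := fun _ τ => ⟨τ.val + 1, by omega⟩
  termP₁ := fun _ _ => 1
  termP₂ := fun _ τ => ⟨τ.val + 2, by omega⟩

/-- `(11)` — the index of `B_(11)`.
[cite: Hu2025, §6.1–§6.2 Def. 6.1/6.3/6.5/6.6/6.7/6.9, pp. 95–106 (unrefereed preprint arXiv:2507.21400v1 under adjudication, D-0012/D-0089 — kernel support on OUR typed carrier of row 107; nothing of the source asserted)] -/
abbrev kτ0 : toy.IndexBgov := ⟨⟨0, by decide⟩, ⟨0, by decide⟩⟩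

/-- `(12)` — the index of `B_(12)`.
[cite: Hu2025, §6.1–§6.2 Def. 6.1/6.3/6.5/6.6/6.7/6.9, pp. 95–106 (unrefereed preprint arXiv:2507.21400v1 under adjudication, D-0012/D-0089 — kernel support on OUR typed carrier of row 107; nothing of the source asserted)] -/
abbrev kτ1 : toy.IndexBgov := ⟨⟨0, by decide⟩, ⟨1, by decide⟩⟩

/-- The geometric TEST of the toy (an explicit relation on names, PARTITION-HU §6 (c)): only the pair `(X_{r₁}, X_{u₁})` meets
`Ṽ`, and only at the stage preceding round 1 of `B_(11)`.
[cite: Hu2025, §6.1–§6.2 Def. 6.1/6.3/6.5/6.6/6.7/6.9, pp. 95–106 (unrefereed preprint arXiv:2507.21400v1 under adjudication, D-0012/D-0089 — kernel support on OUR typed carrier of row 107; nothing of the source asserted)] -/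
abbrev meets (kτ : toy.IndexBgov) (μ : ℕ) (Y Y' : toy.Div) : Prop :=
  kτ = kτ0 ∧ μ = 0 ∧ Y = Div.varrho 1 ∧ Y' = Div.varpi 1

/-- The new ℘-exceptional name `E_{(11)11}`.
[cite: Hu2025, §6.1–§6.2 Def. 6.1/6.3/6.5/6.6/6.7/6.9, pp. 95–106 (unrefereed preprint arXiv:2507.21400v1 under adjudication, D-0012/D-0089 — kernel support on OUR typed carrier of row 107; nothing of the source asserted)] -/
abbrev E11 : toy.Div := Div.excWp 0 1 1 1

/-- The name a divisor copies its INITIAL multiplicities from: itself, except `E_{ℓ_k} ↦ E_{ϑ,k}` (Def. 6.9).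
[cite: Hu2025, §6.1–§6.2 Def. 6.1/6.3/6.5/6.6/6.7/6.9, pp. 95–106 (unrefereed preprint arXiv:2507.21400v1 under adjudication, D-0012/D-0089 — kernel support on OUR typed carrier of row 107; nothing of the source asserted)] -/
abbrev base (Y : toy.Div) : toy.Div :=
  Div.cases Div.varpi Div.varrho Div.ell Div.excTheta (fun x => Div.excWp x.1 x.2.1 x.2.2.1 x.2.2.2) Div.excTheta Y

/-- The Def. 6.1 table (all columns are governing: `Bin = Index_{𝓑^gov}`, `gov = id`).
[cite: Hu2025, §6.1–§6.2 Def. 6.1/6.3/6.5/6.6/6.7/6.9, pp. 95–106 (unrefereed preprint arXiv:2507.21400v1 under adjudication, D-0012/D-0089 — kernel support on OUR typed carrier of row 107; nothing of the source asserted)] -/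
abbrev tab0 : toy.AssocB toy.IndexBgov := fun Y B i => Def6_1 toy (base Y) B i

/-- The Def. 6.3 (OURS reading) table.
[cite: Hu2025, §6.1–§6.2 Def. 6.1/6.3/6.5/6.6/6.7/6.9, pp. 95–106 (unrefereed preprint arXiv:2507.21400v1 under adjudication, D-0012/D-0089 — kernel support on OUR typed carrier of row 107; nothing of the source asserted)] -/
abbrev tabS0 : toy.AssocS := fun Y s => Def6_3_ours toy (base Y) s

/-- The run: `ρ_(11) = 1`, `σ_(11)1 = 1`, `ϕ_(11)11 = (X_{r₁}, X_{u₁})`, `ρ_(12) = 0`; tables = Def. 6.1/6.3 on the old names,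
Def. 6.6 at `E_{(11)11}`, Def. 6.9 at `E_{ℓ_1}` (via `base`).
[cite: Hu2025, §6.1–§6.2 Def. 6.1/6.3/6.5/6.6/6.7/6.9, pp. 95–106 (unrefereed preprint arXiv:2507.21400v1 under adjudication, D-0012/D-0089 — kernel support on OUR typed carrier of row 107; nothing of the source asserted)] -/
abbrev run : toy.WpRun toy.IndexBgov where
  rho := fun kτ => if kτ = kτ0 then 1 else 0
  sigma := fun kτ μ => if kτ = kτ0 ∧ μ = 1 then 1 else 0
  phi := fun _ _ _ => (Div.varrho 1, Div.varpi 1)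
  tabB := fun Y B i => if Y = E11 then toy.Def6_6_exc tab0 (Div.varrho 1) (Div.varpi 1) B i else tab0 Y B i
  tabS := fun Y s => if Y = E11 then toy.Def6_6_excS tabS0 (Div.varrho 1) (Div.varpi 1) s else tabS0 Y s

/-- Def. 6.6 at `E_{(11)11}` gives `(0,0)` for `B_(11)` and `(0,1)` for `B_(12)` (kernel evaluation). -/
example : run.tabB E11 kτ0 0 = 0 ∧ run.tabB E11 kτ0 1 = 0 ∧ run.tabB E11 kτ1 0 = 0 ∧ run.tabB E11 kτ1 1 = 1 := by decide

/-- `X_{r₁}` is a divisor of the stage preceding round 1 of `B_(11)` (a ϱ-name of `𝒟_ϑ`).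
[cite: Hu2025, §6.1–§6.2 Def. 6.1/6.3/6.5/6.6/6.7/6.9, pp. 95–106 (unrefereed preprint arXiv:2507.21400v1 under adjudication, D-0012/D-0089 — kernel support on OUR typed carrier of row 107; nothing of the source asserted)] -/
theorem varrho_mem : (Div.varrho 1 : toy.Div) ∈ toy.divsBefore run.rho run.sigma kτ0 1 :=
  ⟨trivial, Or.inl (Or.inl (Or.inr ⟨1, rfl⟩))⟩

/-- `X_{u₁}` is a divisor of the stage preceding round 1 of `B_(11)` (a ϖ-name of `𝒟_ϑ`).
[cite: Hu2025, §6.1–§6.2 Def. 6.1/6.3/6.5/6.6/6.7/6.9, pp. 95–106 (unrefereed preprint arXiv:2507.21400v1 under adjudication, D-0012/D-0089 — kernel support on OUR typed carrier of row 107; nothing of the source asserted)] -/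
theorem varpi_mem : (Div.varpi 1 : toy.Div) ∈ toy.divsBefore run.rho run.sigma kτ0 1 :=
  ⟨trivial, Or.inl (Or.inl (Or.inl ⟨1, rfl⟩))⟩

/-- The ℘-set `ϕ_(11)11 = {X_{r₁}, X_{u₁}}` of round 1 of `B_(11)` as a pre-℘-set (`X_{r₁}` is associated with `T⁺_(11)`,
`X_{u₁}` with `T⁻_(11)` by Def. 6.1).
[cite: Hu2025, §6.1–§6.2 Def. 6.1/6.3/6.5/6.6/6.7/6.9, pp. 95–106 (unrefereed preprint arXiv:2507.21400v1 under adjudication, D-0012/D-0089 — kernel support on OUR typed carrier of row 107; nothing of the source asserted)] -/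
def φ₀ : PreWpSet toy (toy.divsBefore run.rho run.sigma kτ0 1) (run.col id kτ0) where
  plus := Div.varrho 1
  minus := Div.varpi 1
  plus_mem := varrho_mem
  minus_mem := varpi_mem
  plus_assoc := by unfold WpFrame.IsAssociated; decide
  minus_assoc := by unfold WpFrame.IsAssociated; decide
  plus_ne_minus := by decide

/-- **Non-vacuity of `WpRun.IsAsPrinted` with one ℘-set** (all columns governing, `gov = id`, every column «later», the Plücker
order `<` on `Fin 4`, the test `meets`).
[cite: Hu2025, §6.1–§6.2 Def. 6.1/6.3/6.5/6.6/6.7/6.9, pp. 95–106 (unrefereed preprint arXiv:2507.21400v1 under adjudication, D-0012/D-0089 — kernel support on OUR typed carrier of row 107; nothing of the source asserted)] -/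
theorem run_isAsPrinted : run.IsAsPrinted (· < ·) id (fun _ _ => True) meets := by
  refine ⟨?_, ?_, ?_, ?_, ?_⟩
  · -- (a) initial package on 𝒟_ϑ
    intro Y hY
    rcases hY with (⟨w, rfl⟩ | ⟨r, rfl⟩) | ⟨j, rfl⟩ <;> exact ⟨fun _ _ => rfl, fun _ => rfl⟩
  · -- (b) rounds
    rintro ⟨k, τ⟩ μ h1 h2
    fin_cases k; fin_cases τ
    · have hμ : μ = 1 := by
        have : μ ≤ 1 := by simpa using h2
        omega
      subst hμ
      refine ⟨[φ₀], ⟨?_, List.pairwise_singleton _ _⟩, by simp, ?_⟩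
      · intro φ
        simp only [IsWpSet, List.mem_singleton, exists_eq_left]
        constructor
        · rintro ⟨-, -, hp, hm⟩; exact ⟨hp.symm, hm.symm⟩
        · rintro ⟨hp, hm⟩; exact ⟨rfl, rfl, hp.symm, hm.symm⟩
      · intro h hh
        have h0 : h = 0 := by simp at hh; omega
        subst h0; rfl
    · exfalso
      have : μ ≤ 0 := by simpa using h2
      omega
  · -- (c) Def. 6.6 at E_{(11)11}
    rintro ⟨k, τ⟩ μ h ⟨τ', hτ', h1, h2, h3, h4⟩
    fin_cases k; fin_cases τ <;> fin_cases τ' <;> simp at hτ' h2 h4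
    · have hμ : μ = 1 := by omega
      subst hμ
      have hh : h = 1 := by simp at h4; omega
      subst hh
      decide
    · omega
  · -- (d) ρ_(kτ) = Def. 6.7's least round
    rintro ⟨k, τ⟩
    fin_cases k; fin_cases τ
    · show ((1 : ℕ) : ℕ∞) = _
      apply le_antisymm
      · refine le_iInf₂ fun μ hμ => ?_
        rcases Nat.eq_zero_or_pos μ with rfl | hpos
        · exact absurd (show IsWpSet toy (meets kτ0 0) φ₀ from ⟨rfl, rfl, rfl, rfl⟩) (hμ φ₀)
        · exact_mod_cast hpos
      · exact iInf₂_le (1 : ℕ) fun φ hφ => absurd hφ.2.1 one_ne_zero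
    · show ((0 : ℕ) : ℕ∞) = _
      apply le_antisymm
      · exact bot_le
      · exact iInf₂_le (0 : ℕ) fun φ hφ => absurd hφ.1 (by decide)
  · -- (e) Def. 6.9 at E_{ℓ_1}
    intro k
    fin_cases k
    decide

end R107NonVacuity

/-! ## A two-block witness: an ℓ-exceptional divisor in a later block's ℘-set (clauses (b)+(e) across blocks) -/

namespace R107NonVacuity2

open WpFrame

/-- Two blocks, one governing binomial each: block 1 (`k = 0`): `u_1 = u₀`, `(m,u_1) = r₀`, term `(u_s,v_s) = r₁` with
`u_s = u₁`, `v_s = u₂`; block 2 (`k = 1`): `u_2 = u₃`, `(m,u_2) = r₂`, term `r₃` with `u_s = u₀ (= u_1)`, `v_s = u₁` — so that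
`E_{ϑ,1}` (and hence `E_{ℓ_1}`, Def. 6.9) is associated with `T⁻_(21)` (Def. 6.1: `m_{E_{ϑ,j},T⁻_B} = m_{X_{u_j},T⁻_B}`, `u_1 = u_s`).
[cite: Hu2025, §6.1–§6.2 Def. 6.1/6.3/6.5/6.6/6.7/6.9, pp. 95–106 (unrefereed preprint arXiv:2507.21400v1 under adjudication, D-0012/D-0089 — kernel support on OUR typed carrier of row 107; nothing of the source asserted)] -/
abbrev toy : WpFrame (Fin 4) (Fin 4) where
  N := 2
  t := fun _ => 1
  ult := fun k => if k.val = 0 then 0 else 3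
  lead := fun k => if k.val = 0 then 0 else 2
  termR := fun k _ => if k.val = 0 then 1 else 3
  termP₁ := fun k _ => if k.val = 0 then 1 else 0
  termP₂ := fun k _ => if k.val = 0 then 2 else 1

/-- `(11)`.
[cite: Hu2025, §6.1–§6.2 Def. 6.1/6.3/6.5/6.6/6.7/6.9, pp. 95–106 (unrefereed preprint arXiv:2507.21400v1 under adjudication, D-0012/D-0089 — kernel support on OUR typed carrier of row 107; nothing of the source asserted)] -/
abbrev b1 : toy.IndexBgov := ⟨⟨0, by decide⟩, ⟨0, by decide⟩⟩
/-- `(21)`.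
[cite: Hu2025, §6.1–§6.2 Def. 6.1/6.3/6.5/6.6/6.7/6.9, pp. 95–106 (unrefereed preprint arXiv:2507.21400v1 under adjudication, D-0012/D-0089 — kernel support on OUR typed carrier of row 107; nothing of the source asserted)] -/
abbrev b2 : toy.IndexBgov := ⟨⟨1, by decide⟩, ⟨0, by decide⟩⟩

/-- TESTS: in block 1 only `(X_{r₁}, X_{u₁})` meets `Ṽ` (before round 1); in block 2 only `(X_{u₃}, E_{ℓ_1})` does.
[cite: Hu2025, §6.1–§6.2 Def. 6.1/6.3/6.5/6.6/6.7/6.9, pp. 95–106 (unrefereed preprint arXiv:2507.21400v1 under adjudication, D-0012/D-0089 — kernel support on OUR typed carrier of row 107; nothing of the source asserted)] -/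
abbrev meets (kτ : toy.IndexBgov) (μ : ℕ) (Y Y' : toy.Div) : Prop :=
  (kτ = b1 ∧ μ = 0 ∧ Y = Div.varrho 1 ∧ Y' = Div.varpi 1) ∨ (kτ = b2 ∧ μ = 0 ∧ Y = Div.varpi 3 ∧ Y' = Div.excEll 0)

/-- `E_{(11)11}` and `E_{(21)11}`.
[cite: Hu2025, §6.1–§6.2 Def. 6.1/6.3/6.5/6.6/6.7/6.9, pp. 95–106 (unrefereed preprint arXiv:2507.21400v1 under adjudication, D-0012/D-0089 — kernel support on OUR typed carrier of row 107; nothing of the source asserted)] -/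
abbrev E11 : toy.Div := Div.excWp 0 1 1 1
/-- `E_{(21)11}`.
[cite: Hu2025, §6.1–§6.2 Def. 6.1/6.3/6.5/6.6/6.7/6.9, pp. 95–106 (unrefereed preprint arXiv:2507.21400v1 under adjudication, D-0012/D-0089 — kernel support on OUR typed carrier of row 107; nothing of the source asserted)] -/
abbrev E21 : toy.Div := Div.excWp 1 1 1 1

/-- The name a divisor copies its INITIAL multiplicities from (`E_{ℓ_k} ↦ E_{ϑ,k}`, Def. 6.9).
[cite: Hu2025, §6.1–§6.2 Def. 6.1/6.3/6.5/6.6/6.7/6.9, pp. 95–106 (unrefereed preprint arXiv:2507.21400v1 under adjudication, D-0012/D-0089 — kernel support on OUR typed carrier of row 107; nothing of the source asserted)] -/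
abbrev base (Y : toy.Div) : toy.Div :=
  Div.cases Div.varpi Div.varrho Div.ell Div.excTheta (fun x => Div.excWp x.1 x.2.1 x.2.2.1 x.2.2.2) Div.excTheta Y

/-- The Def. 6.1 table (two governing columns).
[cite: Hu2025, §6.1–§6.2 Def. 6.1/6.3/6.5/6.6/6.7/6.9, pp. 95–106 (unrefereed preprint arXiv:2507.21400v1 under adjudication, D-0012/D-0089 — kernel support on OUR typed carrier of row 107; nothing of the source asserted)] -/
abbrev tab0 : toy.AssocB toy.IndexBgov := fun Y B i => Def6_1 toy (base Y) B i
/-- The Def. 6.3 (OURS reading) table.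
[cite: Hu2025, §6.1–§6.2 Def. 6.1/6.3/6.5/6.6/6.7/6.9, pp. 95–106 (unrefereed preprint arXiv:2507.21400v1 under adjudication, D-0012/D-0089 — kernel support on OUR typed carrier of row 107; nothing of the source asserted)] -/
abbrev tabS0 : toy.AssocS := fun Y s => Def6_3_ours toy (base Y) s

/-- The run: one round with one ℘-set in each block; `E_{(21)11}` is blown up along `X_{u₃} ∩ E_{ℓ_1}`.
[cite: Hu2025, §6.1–§6.2 Def. 6.1/6.3/6.5/6.6/6.7/6.9, pp. 95–106 (unrefereed preprint arXiv:2507.21400v1 under adjudication, D-0012/D-0089 — kernel support on OUR typed carrier of row 107; nothing of the source asserted)] -/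
abbrev run : toy.WpRun toy.IndexBgov where
  rho := fun _ => 1
  sigma := fun _ μ => if μ = 1 then 1 else 0
  phi := fun kτ _ _ => if kτ = b1 then (Div.varrho 1, Div.varpi 1) else (Div.varpi 3, Div.excEll 0)
  tabB := fun Y B i =>
    if Y = E11 then toy.Def6_6_exc tab0 (Div.varrho 1) (Div.varpi 1) B i
    else if Y = E21 then toy.Def6_6_exc tab0 (Div.varpi 3) (Div.excEll 0) B i else tab0 Y B i
  tabS := fun Y s =>
    if Y = E11 then toy.Def6_6_excS tabS0 (Div.varrho 1) (Div.varpi 1) s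
    else if Y = E21 then toy.Def6_6_excS tabS0 (Div.varpi 3) (Div.excEll 0) s else tabS0 Y s

/-- Kernel evaluation of the bookkeeping in the column of `B_(21)`: `E_{ℓ_1}` is associated with `T⁻_(21)` (copy of `E_{ϑ,1}`,
Def. 6.9 + Def. 6.1), so is `E_{(11)11}` (Def. 6.6: `m_ϕ = (0,1)`, `l = 0`), and the new `E_{(21)11}` gets `m_ϕ − l = (1,1) − 1
= (0,0)`. -/
example : run.tabB (Div.excEll 0) b2 1 = 1 ∧ run.tabB (Div.excTheta 0) b2 1 = 1 ∧ run.tabB E11 b2 1 = 1 ∧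
    run.tabB E21 b2 0 = 0 ∧ run.tabB E21 b2 1 = 0 := by decide

/-- `X_{r₁}` is available before round 1 of `B_(11)`.
[cite: Hu2025, §6.1–§6.2 Def. 6.1/6.3/6.5/6.6/6.7/6.9, pp. 95–106 (unrefereed preprint arXiv:2507.21400v1 under adjudication, D-0012/D-0089 — kernel support on OUR typed carrier of row 107; nothing of the source asserted)] -/
theorem varrho1_mem : (Div.varrho 1 : toy.Div) ∈ toy.divsBefore run.rho run.sigma b1 1 :=
  ⟨trivial, Or.inl (Or.inl (Or.inr ⟨1, rfl⟩))⟩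
/-- `X_{u₁}` is available before round 1 of `B_(11)`.
[cite: Hu2025, §6.1–§6.2 Def. 6.1/6.3/6.5/6.6/6.7/6.9, pp. 95–106 (unrefereed preprint arXiv:2507.21400v1 under adjudication, D-0012/D-0089 — kernel support on OUR typed carrier of row 107; nothing of the source asserted)] -/
theorem varpi1_mem : (Div.varpi 1 : toy.Div) ∈ toy.divsBefore run.rho run.sigma b1 1 :=
  ⟨trivial, Or.inl (Or.inl (Or.inl ⟨1, rfl⟩))⟩
/-- `X_{u₃}` is available before round 1 of `B_(21)`.
[cite: Hu2025, §6.1–§6.2 Def. 6.1/6.3/6.5/6.6/6.7/6.9, pp. 95–106 (unrefereed preprint arXiv:2507.21400v1 under adjudication, D-0012/D-0089 — kernel support on OUR typed carrier of row 107; nothing of the source asserted)] -/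
theorem varpi3_mem : (Div.varpi 3 : toy.Div) ∈ toy.divsBefore run.rho run.sigma b2 1 :=
  ⟨trivial, Or.inl (Or.inl (Or.inl ⟨3, rfl⟩))⟩
/-- `E_{ℓ_1}` is a divisor of the stage preceding round 1 of `B_(21)` (`ℓ_1 < (21)11`).
[cite: Hu2025, §6.1–§6.2 Def. 6.1/6.3/6.5/6.6/6.7/6.9, pp. 95–106 (unrefereed preprint arXiv:2507.21400v1 under adjudication, D-0012/D-0089 — kernel support on OUR typed carrier of row 107; nothing of the source asserted)] -/
theorem excEll0_mem : (Div.excEll 0 : toy.Div) ∈ toy.divsBefore run.rho run.sigma b2 1 :=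
  ⟨trivial, Or.inr ⟨Stage.ellStage 0, rfl, by
    simp only [Stage.LT, Stage.ellStage, Stage.wp, Sum.elim_inr, Sum.elim_inl]; decide⟩⟩

/-- `ϕ_(11)11 = {X_{r₁}, X_{u₁}}`.
[cite: Hu2025, §6.1–§6.2 Def. 6.1/6.3/6.5/6.6/6.7/6.9, pp. 95–106 (unrefereed preprint arXiv:2507.21400v1 under adjudication, D-0012/D-0089 — kernel support on OUR typed carrier of row 107; nothing of the source asserted)] -/
def φ₁ : PreWpSet toy (toy.divsBefore run.rho run.sigma b1 1) (run.col id b1) where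
  plus := Div.varrho 1
  minus := Div.varpi 1
  plus_mem := varrho1_mem
  minus_mem := varpi1_mem
  plus_assoc := by unfold WpFrame.IsAssociated; decide
  minus_assoc := by unfold WpFrame.IsAssociated; decide
  plus_ne_minus := by decide

/-- `ϕ_(21)11 = {X_{u₃}, E_{ℓ_1}}` — an ℓ-exceptional divisor in a ℘-set of the next block.
[cite: Hu2025, §6.1–§6.2 Def. 6.1/6.3/6.5/6.6/6.7/6.9, pp. 95–106 (unrefereed preprint arXiv:2507.21400v1 under adjudication, D-0012/D-0089 — kernel support on OUR typed carrier of row 107; nothing of the source asserted)] -/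
def φ₂ : PreWpSet toy (toy.divsBefore run.rho run.sigma b2 1) (run.col id b2) where
  plus := Div.varpi 3
  minus := Div.excEll 0
  plus_mem := varpi3_mem
  minus_mem := excEll0_mem
  plus_assoc := by unfold WpFrame.IsAssociated; decide
  minus_assoc := by unfold WpFrame.IsAssociated; decide
  plus_ne_minus := by decide

/-- **Non-vacuity of `WpRun.IsAsPrinted` across two blocks** (ℓ-step feeding the next block's ℘-sets).
[cite: Hu2025, §6.1–§6.2 Def. 6.1/6.3/6.5/6.6/6.7/6.9, pp. 95–106 (unrefereed preprint arXiv:2507.21400v1 under adjudication, D-0012/D-0089 — kernel support on OUR typed carrier of row 107; nothing of the source asserted)] -/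
theorem run_isAsPrinted : run.IsAsPrinted (· < ·) id (fun _ _ => True) meets := by
  refine ⟨?_, ?_, ?_, ?_, ?_⟩
  · -- (a)
    intro Y hY
    rcases hY with (⟨w, rfl⟩ | ⟨r, rfl⟩) | ⟨j, rfl⟩ <;> exact ⟨fun _ _ => rfl, fun _ => rfl⟩
  · -- (b)
    rintro ⟨k, τ⟩ μ h1 h2
    have hle : μ ≤ 1 := by simpa using h2
    have hμ : μ = 1 := by omega
    subst hμ
    fin_cases k <;> fin_cases τ
    · refine ⟨[φ₁], ⟨?_, List.pairwise_singleton _ _⟩, by simp, ?_⟩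
      · intro φ
        simp only [IsWpSet, List.mem_singleton, exists_eq_left]
        constructor
        · rintro (⟨-, -, hp, hm⟩ | ⟨h, -⟩)
          · exact ⟨hp.symm, hm.symm⟩
          · exact absurd h (by decide)
        · rintro ⟨hp, hm⟩; exact Or.inl ⟨rfl, rfl, hp.symm, hm.symm⟩
      · intro h hh
        have h0 : h = 0 := by simp at hh; omega
        subst h0; rfl
    · refine ⟨[φ₂], ⟨?_, List.pairwise_singleton _ _⟩, by simp, ?_⟩
      · intro φ
        simp only [IsWpSet, List.mem_singleton, exists_eq_left]
        constructor
        · rintro (⟨h, -⟩ | ⟨-, -, hp, hm⟩)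
          · exact absurd h (by decide)
          · exact ⟨hp.symm, hm.symm⟩
        · rintro ⟨hp, hm⟩; exact Or.inr ⟨rfl, rfl, hp.symm, hm.symm⟩
      · intro h hh
        have h0 : h = 0 := by simp at hh; omega
        subst h0; rfl
  · -- (c)
    rintro ⟨k, τ⟩ μ h ⟨τ', hτ', h1, h2, h3, h4⟩
    have hle : μ ≤ 1 := by simpa using h2
    have hμ : μ = 1 := by omega
    subst hμ
    have hh : h = 1 := by simp at h4; omega
    subst hh
    fin_cases k <;> fin_cases τ <;> decide
  · -- (d)
    rintro ⟨k, τ⟩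
    fin_cases k <;> fin_cases τ
    · show ((1 : ℕ) : ℕ∞) = _
      apply le_antisymm
      · refine le_iInf₂ fun μ hμ => ?_
        rcases Nat.eq_zero_or_pos μ with rfl | hpos
        · exact absurd (show IsWpSet toy (meets b1 0) φ₁ from Or.inl ⟨rfl, rfl, rfl, rfl⟩) (hμ φ₁)
        · exact_mod_cast hpos
      · exact iInf₂_le (1 : ℕ) fun φ hφ => by
          rcases hφ with ⟨-, h, -⟩ | ⟨h, -⟩
          · exact absurd h one_ne_zero
          · exact absurd h (by decide)
    · show ((1 : ℕ) : ℕ∞) = _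
      apply le_antisymm
      · refine le_iInf₂ fun μ hμ => ?_
        rcases Nat.eq_zero_or_pos μ with rfl | hpos
        · exact absurd (show IsWpSet toy (meets b2 0) φ₂ from Or.inr ⟨rfl, rfl, rfl, rfl⟩) (hμ φ₂)
        · exact_mod_cast hpos
      · exact iInf₂_le (1 : ℕ) fun φ hφ => by
          rcases hφ with ⟨h, -⟩ | ⟨-, h, -⟩
          · exact absurd h (by decide)
          · exact absurd h one_ne_zero
  · -- (e)
    intro k
    fin_cases k <;> decide

end R107NonVacuity2

/-! ## A round with TWO ℘-sets: Def. 6.5's order decides which centre is blown up first (clause (b), σ = 2) -/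

namespace R107NonVacuity3

open WpFrame R107NonVacuity

/-- TEST on the one-block frame `R107NonVacuity.toy`: before round 1 of `B_(11)` exactly the pairs `(X_{u_1}, X_{u₁})` and
`(X_{r₁}, X_{u₁})` meet `Ṽ` (here `u_1 = u₀` is the leading variable, `X_{r₁} = X_{(u_s,v_s)}`).
[cite: Hu2025, §6.1–§6.2 Def. 6.1/6.3/6.5/6.6/6.7/6.9, pp. 95–106 (unrefereed preprint arXiv:2507.21400v1 under adjudication, D-0012/D-0089 — kernel support on OUR typed carrier of row 107; nothing of the source asserted)] -/
abbrev meets (kτ : toy.IndexBgov) (μ : ℕ) (Y Y' : toy.Div) : Prop :=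
  kτ = kτ0 ∧ μ = 0 ∧ Y' = Div.varpi 1 ∧ (Y = Div.varpi 0 ∨ Y = Div.varrho 1)

/-- `E_{(11)11}` (centre `X_{u_1} ∩ X_{u₁}`, listed FIRST: `X_{u_k}` is the second largest in `𝒟⁺`, `X_{(u_s,v_s)}` the largest,
and the listing is increasing) and `E_{(11)12}` (centre `X_{r₁} ∩ X_{u₁}`).
[cite: Hu2025, §6.1–§6.2 Def. 6.1/6.3/6.5/6.6/6.7/6.9, pp. 95–106 (unrefereed preprint arXiv:2507.21400v1 under adjudication, D-0012/D-0089 — kernel support on OUR typed carrier of row 107; nothing of the source asserted)] -/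
abbrev E11 : toy.Div := Div.excWp 0 1 1 1

/-- `E_{(11)12}` (centre `X_{r₁} ∩ X_{u₁}`, the second ℘-set of round 1).
[cite: Hu2025, §6.1–§6.2 Def. 6.1/6.3/6.5/6.6/6.7/6.9, pp. 95–106 (unrefereed preprint arXiv:2507.21400v1 under adjudication, D-0012/D-0089 — kernel support on OUR typed carrier of row 107; nothing of the source asserted)] -/
abbrev E12 : toy.Div := Div.excWp 0 1 1 2

/-- The run with `σ_(11)1 = 2`.
[cite: Hu2025, §6.1–§6.2 Def. 6.1/6.3/6.5/6.6/6.7/6.9, pp. 95–106 (unrefereed preprint arXiv:2507.21400v1 under adjudication, D-0012/D-0089 — kernel support on OUR typed carrier of row 107; nothing of the source asserted)] -/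
abbrev run : toy.WpRun toy.IndexBgov where
  rho := fun kτ => if kτ = kτ0 then 1 else 0
  sigma := fun kτ μ => if kτ = kτ0 ∧ μ = 1 then 2 else 0
  phi := fun _ _ h => if h = 1 then (Div.varpi 0, Div.varpi 1) else (Div.varrho 1, Div.varpi 1)
  tabB := fun Y B i =>
    if Y = E11 then toy.Def6_6_exc tab0 (Div.varpi 0) (Div.varpi 1) B i
    else if Y = E12 then toy.Def6_6_exc tab0 (Div.varrho 1) (Div.varpi 1) B i else tab0 Y B i
  tabS := fun Y s =>
    if Y = E11 then toy.Def6_6_excS tabS0 (Div.varpi 0) (Div.varpi 1) s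
    else if Y = E12 then toy.Def6_6_excS tabS0 (Div.varrho 1) (Div.varpi 1) s else tabS0 Y s

/-- `X_{u_1}` (the leading variable's divisor) is available before round 1 of `B_(11)`.
[cite: Hu2025, §6.1–§6.2 Def. 6.1/6.3/6.5/6.6/6.7/6.9, pp. 95–106 (unrefereed preprint arXiv:2507.21400v1 under adjudication, D-0012/D-0089 — kernel support on OUR typed carrier of row 107; nothing of the source asserted)] -/
theorem varpi0_mem : (Div.varpi 0 : toy.Div) ∈ toy.divsBefore run.rho run.sigma kτ0 1 :=
  ⟨trivial, Or.inl (Or.inl (Or.inl ⟨0, rfl⟩))⟩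
/-- `X_{u₁}` is available before round 1 of `B_(11)`.
[cite: Hu2025, §6.1–§6.2 Def. 6.1/6.3/6.5/6.6/6.7/6.9, pp. 95–106 (unrefereed preprint arXiv:2507.21400v1 under adjudication, D-0012/D-0089 — kernel support on OUR typed carrier of row 107; nothing of the source asserted)] -/
theorem varpi1_mem : (Div.varpi 1 : toy.Div) ∈ toy.divsBefore run.rho run.sigma kτ0 1 :=
  ⟨trivial, Or.inl (Or.inl (Or.inl ⟨1, rfl⟩))⟩
/-- `X_{r₁}` is available before round 1 of `B_(11)`.
[cite: Hu2025, §6.1–§6.2 Def. 6.1/6.3/6.5/6.6/6.7/6.9, pp. 95–106 (unrefereed preprint arXiv:2507.21400v1 under adjudication, D-0012/D-0089 — kernel support on OUR typed carrier of row 107; nothing of the source asserted)] -/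
theorem varrho1_mem : (Div.varrho 1 : toy.Div) ∈ toy.divsBefore run.rho run.sigma kτ0 1 :=
  ⟨trivial, Or.inl (Or.inl (Or.inr ⟨1, rfl⟩))⟩

/-- `ϕ_(11)11 = {X_{u_1}, X_{u₁}}`.
[cite: Hu2025, §6.1–§6.2 Def. 6.1/6.3/6.5/6.6/6.7/6.9, pp. 95–106 (unrefereed preprint arXiv:2507.21400v1 under adjudication, D-0012/D-0089 — kernel support on OUR typed carrier of row 107; nothing of the source asserted)] -/
def φ₁ : PreWpSet toy (toy.divsBefore run.rho run.sigma kτ0 1) (run.col id kτ0) where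
  plus := Div.varpi 0
  minus := Div.varpi 1
  plus_mem := varpi0_mem
  minus_mem := varpi1_mem
  plus_assoc := by unfold WpFrame.IsAssociated; decide
  minus_assoc := by unfold WpFrame.IsAssociated; decide
  plus_ne_minus := by decide

/-- `ϕ_(11)12 = {X_{r₁}, X_{u₁}}`.
[cite: Hu2025, §6.1–§6.2 Def. 6.1/6.3/6.5/6.6/6.7/6.9, pp. 95–106 (unrefereed preprint arXiv:2507.21400v1 under adjudication, D-0012/D-0089 — kernel support on OUR typed carrier of row 107; nothing of the source asserted)] -/
def φ₂ : PreWpSet toy (toy.divsBefore run.rho run.sigma kτ0 1) (run.col id kτ0) where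
  plus := Div.varrho 1
  minus := Div.varpi 1
  plus_mem := varrho1_mem
  minus_mem := varpi1_mem
  plus_assoc := by unfold WpFrame.IsAssociated; decide
  minus_assoc := by unfold WpFrame.IsAssociated; decide
  plus_ne_minus := by decide

/-- Def. 6.5: `ϕ_(11)11 < ϕ_(11)12` because `X_{u_k} < X_{(u_s,v_s)}` in `𝒟⁺` (kernel).
[cite: Hu2025, §6.1–§6.2 Def. 6.1/6.3/6.5/6.6/6.7/6.9, pp. 95–106 (unrefereed preprint arXiv:2507.21400v1 under adjudication, D-0012/D-0089 — kernel support on OUR typed carrier of row 107; nothing of the source asserted)] -/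
theorem phi_lt : toy.Def6_5_phiLT (· < ·) kτ0 φ₁ φ₂ :=
  Or.inl (Or.inl ⟨rfl, by decide⟩)

/-- **Non-vacuity with σ = 2**: the listing `[ϕ_(11)11, ϕ_(11)12]` is the increasing enumeration of the two ℘-sets, the
centre `X_{u_1} ∩ X_{u₁}` is blown up first, and both new names get Def. 6.6's multiplicities.
[cite: Hu2025, §6.1–§6.2 Def. 6.1/6.3/6.5/6.6/6.7/6.9, pp. 95–106 (unrefereed preprint arXiv:2507.21400v1 under adjudication, D-0012/D-0089 — kernel support on OUR typed carrier of row 107; nothing of the source asserted)] -/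
theorem run_isAsPrinted : run.IsAsPrinted (· < ·) id (fun _ _ => True) meets := by
  refine ⟨?_, ?_, ?_, ?_, ?_⟩
  · -- (a)
    intro Y hY
    rcases hY with (⟨w, rfl⟩ | ⟨r, rfl⟩) | ⟨j, rfl⟩ <;> exact ⟨fun _ _ => rfl, fun _ => rfl⟩
  · -- (b)
    rintro ⟨k, τ⟩ μ h1 h2
    fin_cases k; fin_cases τ
    · have hle : μ ≤ 1 := by simpa using h2
      have hμ : μ = 1 := by omega
      subst hμ
      refine ⟨[φ₁, φ₂], ⟨?_, List.pairwise_pair.mpr ⟨phi_lt, fun h => absurd h.1 (by decide)⟩⟩, by simp, ?_⟩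
      · intro φ
        simp only [IsWpSet, List.mem_cons, List.not_mem_nil, or_false]
        constructor
        · rintro ⟨-, -, hm, hp | hp⟩
          · exact ⟨φ₁, Or.inl rfl, hp.symm, hm.symm⟩
          · exact ⟨φ₂, Or.inr rfl, hp.symm, hm.symm⟩
        · rintro ⟨ψ, rfl | rfl, hp, hm⟩
          · exact ⟨rfl, rfl, hm.symm, Or.inl hp.symm⟩
          · exact ⟨rfl, rfl, hm.symm, Or.inr hp.symm⟩
      · intro h hh
        have hh' : h < 2 := by simpa using hh
        obtain rfl | rfl : h = 0 ∨ h = 1 := by omega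
        · rfl
        · rfl
    · exfalso
      have : μ ≤ 0 := by simpa using h2
      omega
  · -- (c)
    rintro ⟨k, τ⟩ μ h ⟨τ', hτ', h1, h2, h3, h4⟩
    fin_cases k; fin_cases τ <;> fin_cases τ' <;> simp at hτ' h2 h4
    · have hμ : μ = 1 := by omega
      subst hμ
      have hh : h ≤ 2 := by simpa using h4
      obtain rfl | rfl : h = 1 ∨ h = 2 := by omega
      · decide
      · decide
    · omega
  · -- (d)
    rintro ⟨k, τ⟩
    fin_cases k; fin_cases τ
    · show ((1 : ℕ) : ℕ∞) = _
      apply le_antisymm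
      · refine le_iInf₂ fun μ hμ => ?_
        rcases Nat.eq_zero_or_pos μ with rfl | hpos
        · exact absurd (show IsWpSet toy (meets kτ0 0) φ₁ from ⟨rfl, rfl, rfl, Or.inl rfl⟩) (hμ φ₁)
        · exact_mod_cast hpos
      · exact iInf₂_le (1 : ℕ) fun φ hφ => absurd hφ.2.1 one_ne_zero
    · show ((0 : ℕ) : ℕ∞) = _
      apply le_antisymm
      · exact bot_le
      · exact iInf₂_le (0 : ℕ) fun φ hφ => absurd hφ.1 (by decide)
  · -- (e)
    intro k
    fin_cases k
    decide

end R107NonVacuity3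

end Literature.AlgebraicGeometry.Hu2025.Statements.S06WpEllBlowups
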